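import Summits.Parity.GeneralizedHardyLittlewood.Theorems.BeyondDiagonalBeatsQuarter.OffDiagSliceTransformBounds
import Summits.Parity.GeneralizedHardyLittlewood.Theorems.BeyondDiagonalBeatsQuarter.OffDiagPoissonTwistedSmooth
import Mathlib.Analysis.Calculus.ParametricIntegral
import HarnessLib

/-!
# Route `PrimeLevelFamEdge`, crux K_B (stmt-Parity-20343), line `diagonal_kernel_split` rev 4, plan Ω,
# a8P closable principal piece (input (e)/I3 of `OffDiagPrincipalClosableTotal`, generic half) — **the
# `t₁`-transform of a smooth compactly supported weight is differentiable in the HEIGHT `y`, with derivative the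
# transform of `∂₂Φ`, and continuous** (differentiation under the integral)

The Gallagher–Sobolev device of `OffDiagKFamilySobolev.sum_norm_family_weight_le_of_hasDerivAt` (worker-3, I3)
takes, for each pair `p`, a `C¹` family `y ↦ g p y` with `HasDerivAt (g p) (g′ p y) y`, `ContinuousOn (g′ p)`, and
bounds `‖g p y₀‖ ≤ B₀`, `‖g′ p y‖ ≤ B₁`. For the a8P samples `g p y = 𝓕(t₁ ↦ Φ_p(t₁, y))(ξ)` this file supplies
the calculus, for ANY `Φ : ℝ → ℝ → ℂ` with `uncurry Φ` smooth of compact support: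

* `hasDerivAt_slice_right'`, `deriv_slice_right_eq` — `∂₂Φ(t₁,y) = DF(t₁,y)(0,1)`, `F = uncurry Φ`;
* `contDiff_uncurry_sliceDeriv`, `hasCompactSupport_uncurry_sliceDeriv`, `exists_sliceDeriv_bound_box` — `∂₂Φ` is
  again smooth of compact support, bounded (`‖∂₂Φ‖ ≤ M`) and supported in a box `[-R,R]²`;
* **`hasDerivAt_fourier_slice`** — `HasDerivAt (y ↦ 𝓕(t₁ ↦ Φ(t₁,y))(ξ)) (𝓕(t₁ ↦ ∂₂Φ(t₁,y₀))(ξ)) y₀`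
  (`hasDerivAt_integral_of_dominated_loc_of_deriv_le`, dominator `M·𝟙_{[-R,R]}`);
* **`continuous_fourier_slice`** — `y ↦ 𝓕(t₁ ↦ Φ(t₁,y))(ξ)` is continuous (it is differentiable), hence so is
  the derivative family (apply it to `∂₂Φ`): `continuous_fourier_sliceDeriv`;
* `norm_fourier_sliceDeriv_le` — `‖𝓕(t₁ ↦ ∂₂Φ(t₁,y))(ξ)‖ ≤ M·(2R)` (`OffDiagSliceTransformBounds`).

The K_B constants (`B₁` for `Φ = boxWeightU`, of size `≍ (1+Z+X)/K₂·B₀`) are the companion file (e2).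
Generic analysis; theorems only; standard axioms. Helper toward `stub_offDiagBelowSlack_io`
(`--supports stmt-Parity-20343`); closes nothing.
«The programme SEARCHES and TYPES; no claim about Landau–Siegel zeros, Theorems 1–2 of arXiv:2211.02515 or
a repaired Margin232 until a kernel theorem says so.»
-/

noncomputable section

open Set MeasureTheory Filter
open scoped Real FourierTransform ContDiff Topology

namespace Summit.Parity.GeneralizedHardyLittlewood.Theorems.BeyondDiagonalBeatsQuarter.OffDiag

open Literature.NumberTheory.Sieve.FriedlanderIwaniecPrimes (ker norm_ker continuous_ker fourier_eq_integral_ker)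
open OffDiagPoissonTwisted (exists_tsupport_subset_box)

variable {Φ : ℝ → ℝ → ℂ}

/-! ### §1. The partial derivative in the height variable -/

/-- **The height derivative of a slice**: `HasDerivAt (Φ t₁) (DF(t₁,y)(0,1)) y` for `F = uncurry Φ` smooth. [folklore] -/
theorem hasDerivAt_slice_right' (hΦ : ContDiff ℝ ∞ (Function.uncurry Φ)) (t₁ y : ℝ) :
    HasDerivAt (Φ t₁) (fderiv ℝ (Function.uncurry Φ) (t₁, y) ((0 : ℝ), (1 : ℝ))) y := by
  have h1 : HasFDerivAt (Function.uncurry Φ) (fderiv ℝ (Function.uncurry Φ) (t₁, y)) (t₁, y) :=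
    ((hΦ.differentiable (by simp)) (t₁, y)).hasFDerivAt
  have h2 : HasDerivAt (fun y : ℝ ↦ (t₁, y)) ((0 : ℝ), (1 : ℝ)) y :=
    (hasDerivAt_const y t₁).prodMk (hasDerivAt_id y)
  exact h1.comp_hasDerivAt y h2

/-- `∂₂Φ(t₁,y) = DF(t₁,y)(0,1)`. [folklore] -/
theorem deriv_slice_right_eq (hΦ : ContDiff ℝ ∞ (Function.uncurry Φ)) (t₁ y : ℝ) :
    deriv (Φ t₁) y = fderiv ℝ (Function.uncurry Φ) (t₁, y) ((0 : ℝ), (1 : ℝ)) :=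
  (hasDerivAt_slice_right' hΦ t₁ y).deriv

/-- The height-derivative family, uncurried, is `p ↦ DF(p)(0,1)`. [folklore] -/
theorem uncurry_sliceDeriv (Φ : ℝ → ℝ → ℂ) :
    Function.uncurry (fun t₁ y : ℝ ↦ fderiv ℝ (Function.uncurry Φ) (t₁, y) ((0 : ℝ), (1 : ℝ))) =
      fun p : ℝ × ℝ ↦ fderiv ℝ (Function.uncurry Φ) p ((0 : ℝ), (1 : ℝ)) := by
  funext p
  rfl

/-- **`∂₂Φ` is smooth** (as a function of two variables). [folklore] -/
theorem contDiff_uncurry_sliceDeriv (hΦ : ContDiff ℝ ∞ (Function.uncurry Φ)) :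
    ContDiff ℝ ∞ (Function.uncurry (fun t₁ y : ℝ ↦ fderiv ℝ (Function.uncurry Φ) (t₁, y) ((0 : ℝ), (1 : ℝ)))) := by
  rw [uncurry_sliceDeriv]
  exact (hΦ.fderiv_right (m := ∞) (by exact_mod_cast le_rfl)).clm_apply contDiff_const

/-- **`∂₂Φ` has compact support.** [folklore] -/
theorem hasCompactSupport_uncurry_sliceDeriv (hΦc : HasCompactSupport (Function.uncurry Φ)) :
    HasCompactSupport
      (Function.uncurry (fun t₁ y : ℝ ↦ fderiv ℝ (Function.uncurry Φ) (t₁, y) ((0 : ℝ), (1 : ℝ)))) := by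
  rw [uncurry_sliceDeriv]
  refine (hΦc.fderiv (𝕜 := ℝ)).mono fun p hp ↦ ?_
  rw [Function.mem_support] at hp ⊢
  intro h0
  exact hp (by simp [h0])

/-- **`∂₂Φ` is continuous** (jointly). [folklore] -/
theorem continuous_sliceDeriv (hΦ : ContDiff ℝ ∞ (Function.uncurry Φ)) :
    Continuous fun p : ℝ × ℝ ↦ fderiv ℝ (Function.uncurry Φ) p ((0 : ℝ), (1 : ℝ)) :=
  (hΦ.continuous_fderiv (by simp)).clm_apply continuous_const

/-- **Box and bound for `Φ` and `∂₂Φ`.** There are `R > 0` and `M ≥ 0` with: `Φ(t₁,y) = 0` and `∂₂Φ(t₁,y) = 0`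
whenever `|t₁| > R` (or `|y| > R`), and `‖∂₂Φ(t₁,y)‖ ≤ M` everywhere. [folklore] -/
theorem exists_sliceDeriv_bound_box (hΦ : ContDiff ℝ ∞ (Function.uncurry Φ))
    (hΦc : HasCompactSupport (Function.uncurry Φ)) :
    ∃ R M : ℝ, 0 < R ∧ 0 ≤ M ∧
      (∀ t₁ y, R < |t₁| → Φ t₁ y = 0) ∧
      (∀ t₁ y, R < |t₁| → fderiv ℝ (Function.uncurry Φ) (t₁, y) ((0 : ℝ), (1 : ℝ)) = 0) ∧
      (∀ t₁ y, ‖fderiv ℝ (Function.uncurry Φ) (t₁, y) ((0 : ℝ), (1 : ℝ))‖ ≤ M) := by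
  obtain ⟨R, hR0, hR⟩ := exists_tsupport_subset_box hΦc
  obtain ⟨M, hM⟩ := (hΦc.fderiv (𝕜 := ℝ)).exists_bound_of_continuous
    (hΦ.continuous_fderiv (by simp))
  have hM0 : 0 ≤ M := le_trans (norm_nonneg _) (hM (0, 0))
  refine ⟨R, M, hR0, hM0, ?_, ?_, ?_⟩
  · intro t₁ y ht
    by_contra hne
    have hp : (t₁, y) ∈ tsupport (Function.uncurry Φ) :=
      subset_tsupport _ (Function.mem_support.mpr (show Function.uncurry Φ (t₁, y) ≠ 0 from hne))
    exact (not_le.mpr ht) (hR _ hp).1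
  · intro t₁ y ht
    have hp : (t₁, y) ∉ tsupport (Function.uncurry Φ) := fun hp ↦ (not_le.mpr ht) (hR _ hp).1
    have h0 : fderiv ℝ (Function.uncurry Φ) (t₁, y) = 0 :=
      Function.notMem_support.mp fun h ↦ hp (support_fderiv_subset ℝ h)
    simp [h0]
  · intro t₁ y
    calc ‖fderiv ℝ (Function.uncurry Φ) (t₁, y) ((0 : ℝ), (1 : ℝ))‖
        ≤ ‖fderiv ℝ (Function.uncurry Φ) (t₁, y)‖ * ‖((0 : ℝ), (1 : ℝ))‖ := ContinuousLinearMap.le_opNorm _ _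
      _ ≤ M * 1 := by
          refine mul_le_mul (hM _) ?_ (norm_nonneg _) hM0
          simp [Prod.norm_def]
      _ = M := mul_one M

/-! ### §2. Differentiation under the `t₁`-integral -/

/-- **The `t₁`-transform is differentiable in the height, with derivative the transform of `∂₂Φ`.** For
`uncurry Φ` smooth of compact support, every `ξ` and `y₀`:
`HasDerivAt (y ↦ 𝓕(t₁ ↦ Φ(t₁,y))(ξ)) (𝓕(t₁ ↦ ∂₂Φ(t₁,y₀))(ξ)) y₀`. [folklore] -/
theorem hasDerivAt_fourier_slice (hΦ : ContDiff ℝ ∞ (Function.uncurry Φ))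
    (hΦc : HasCompactSupport (Function.uncurry Φ)) (ξ y₀ : ℝ) :
    HasDerivAt (fun y : ℝ ↦ 𝓕 (fun t₁ : ℝ ↦ Φ t₁ y) ξ)
      (𝓕 (fun t₁ : ℝ ↦ fderiv ℝ (Function.uncurry Φ) (t₁, y₀) ((0 : ℝ), (1 : ℝ))) ξ) y₀ := by
  obtain ⟨R, M, hR0, hM0, hΦzero, hDzero, hDle⟩ := exists_sliceDeriv_bound_box hΦ hΦc
  have hk : Continuous fun v : ℝ ↦ ker v ξ := continuous_ker.comp (continuous_id.prodMk continuous_const)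
  -- the integrands
  set F : ℝ → ℝ → ℂ := fun y v ↦ ker v ξ * Φ v y with hF
  set F' : ℝ → ℝ → ℂ := fun y v ↦ ker v ξ * fderiv ℝ (Function.uncurry Φ) (v, y) ((0 : ℝ), (1 : ℝ)) with hF'
  have hslice_cont : ∀ y, Continuous fun v : ℝ ↦ Φ v y := fun y ↦
    hΦ.continuous.comp (continuous_id.prodMk continuous_const)
  have hF_meas : ∀ᶠ y in 𝓝 y₀, AEStronglyMeasurable (F y) volume :=
    Filter.Eventually.of_forall fun y ↦ (hk.mul (hslice_cont y)).aestronglyMeasurable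
  have hF_int : Integrable (F y₀) volume := by
    refine integrable_ker_mul (hslice_cont y₀) (hasCompactSupport_of_support_Icc (a := -R) (b := R) ?_) ξ
    intro t ht
    refine hΦzero t y₀ ?_
    rw [mem_Icc, ← abs_le] at ht
    exact not_le.mp ht
  have hF'_meas : AEStronglyMeasurable (F' y₀) volume :=
    (hk.mul ((continuous_sliceDeriv hΦ).comp (continuous_id.prodMk continuous_const))).aestronglyMeasurable
  -- the dominator `M·𝟙_{[-R,R]}`
  set bound : ℝ → ℝ := (Icc (-R) R).indicator fun _ ↦ M with hbound
  have h_bound : ∀ᵐ v ∂volume, ∀ y ∈ (Set.univ : Set ℝ), ‖F' y v‖ ≤ bound v := by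
    refine Filter.Eventually.of_forall fun v y _ ↦ ?_
    simp only [hF', hbound, Set.indicator_apply]
    split_ifs with hv
    · rw [norm_mul, norm_ker, one_mul]; exact hDle v y
    · rw [mem_Icc, ← abs_le, not_le] at hv
      rw [hDzero v y hv, mul_zero, norm_zero]
  have bound_integrable : Integrable bound volume :=
    (integrableOn_const (measure_Icc_lt_top (a := -R) (b := R)).ne).integrable_indicator measurableSet_Icc
  have h_diff : ∀ᵐ v ∂volume, ∀ y ∈ (Set.univ : Set ℝ), HasDerivAt (F · v) (F' y v) y :=
    Filter.Eventually.of_forall fun v y _ ↦ (hasDerivAt_slice_right' hΦ v y).const_mul (ker v ξ)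
  have hmain := (hasDerivAt_integral_of_dominated_loc_of_deriv_le Filter.univ_mem hF_meas hF_int hF'_meas
    h_bound bound_integrable h_diff).2
  have heq : (fun y : ℝ ↦ 𝓕 (fun t₁ : ℝ ↦ Φ t₁ y) ξ) = fun y ↦ ∫ v, F y v := by
    funext y; rw [fourier_eq_integral_ker]
  rw [heq, fourier_eq_integral_ker]
  exact hmain

/-- **The `t₁`-transform is continuous in the height** (it is differentiable). [folklore] -/
theorem continuous_fourier_slice (hΦ : ContDiff ℝ ∞ (Function.uncurry Φ))
    (hΦc : HasCompactSupport (Function.uncurry Φ)) (ξ : ℝ) :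
    Continuous fun y : ℝ ↦ 𝓕 (fun t₁ : ℝ ↦ Φ t₁ y) ξ :=
  continuous_iff_continuousAt.mpr fun y ↦ (hasDerivAt_fourier_slice hΦ hΦc ξ y).continuousAt

/-- **The derivative family is continuous in the height** (apply the previous to `∂₂Φ`, again smooth of compact
support). [folklore] -/
theorem continuous_fourier_sliceDeriv (hΦ : ContDiff ℝ ∞ (Function.uncurry Φ))
    (hΦc : HasCompactSupport (Function.uncurry Φ)) (ξ : ℝ) :
    Continuous fun y : ℝ ↦ 𝓕 (fun t₁ : ℝ ↦ fderiv ℝ (Function.uncurry Φ) (t₁, y) ((0 : ℝ), (1 : ℝ))) ξ :=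
  continuous_fourier_slice (Φ := fun t₁ y : ℝ ↦ fderiv ℝ (Function.uncurry Φ) (t₁, y) ((0 : ℝ), (1 : ℝ)))
    (contDiff_uncurry_sliceDeriv hΦ) (hasCompactSupport_uncurry_sliceDeriv hΦc) ξ

/-- **Bound for the derivative family**: if `∂₂Φ(t₁,y) = 0` for `t₁ ∉ [a,b]` and `‖∂₂Φ‖ ≤ M` everywhere, then
`‖𝓕(t₁ ↦ ∂₂Φ(t₁,y))(ξ)‖ ≤ M·(b − a)` — the `B₁` slot of the Sobolev device. [folklore] -/
theorem norm_fourier_sliceDeriv_le {a b M : ℝ} (hab : a ≤ b)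
    (hM : ∀ t₁ y, ‖fderiv ℝ (Function.uncurry Φ) (t₁, y) ((0 : ℝ), (1 : ℝ))‖ ≤ M)
    (hzero : ∀ t₁ y, t₁ ∉ Icc a b → fderiv ℝ (Function.uncurry Φ) (t₁, y) ((0 : ℝ), (1 : ℝ)) = 0)
    (y ξ : ℝ) :
    ‖𝓕 (fun t₁ : ℝ ↦ fderiv ℝ (Function.uncurry Φ) (t₁, y) ((0 : ℝ), (1 : ℝ))) ξ‖ ≤ M * (b - a) :=
  norm_fourier_le_of_norm_le_of_support hab (fun t₁ ↦ hM t₁ y) (fun t₁ ht ↦ hzero t₁ y ht) ξ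

/-- **Packaged (e1)**: for `uncurry Φ` smooth of compact support there are `R > 0`, `M ≥ 0` such that for every
`ξ`: `g(y) := 𝓕(t₁ ↦ Φ(t₁,y))(ξ)` has derivative `g′(y) = 𝓕(t₁ ↦ ∂₂Φ(t₁,y))(ξ)` everywhere, `g′` is continuous,
and `‖g′(y)‖ ≤ M·(2R)` — the hypotheses `hg`, `hg′`, `B₁` of `sum_norm_family_weight_le_of_hasDerivAt`. [folklore] -/
theorem fourier_slice_height_regularity (hΦ : ContDiff ℝ ∞ (Function.uncurry Φ))
    (hΦc : HasCompactSupport (Function.uncurry Φ)) :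
    ∃ R M : ℝ, 0 < R ∧ 0 ≤ M ∧ ∀ ξ : ℝ,
      (∀ y, HasDerivAt (fun y : ℝ ↦ 𝓕 (fun t₁ : ℝ ↦ Φ t₁ y) ξ)
        (𝓕 (fun t₁ : ℝ ↦ fderiv ℝ (Function.uncurry Φ) (t₁, y) ((0 : ℝ), (1 : ℝ))) ξ) y) ∧
      Continuous (fun y : ℝ ↦ 𝓕 (fun t₁ : ℝ ↦ fderiv ℝ (Function.uncurry Φ) (t₁, y) ((0 : ℝ), (1 : ℝ))) ξ) ∧
      (∀ y, ‖𝓕 (fun t₁ : ℝ ↦ fderiv ℝ (Function.uncurry Φ) (t₁, y) ((0 : ℝ), (1 : ℝ))) ξ‖ ≤ M * (2 * R)) := by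
  obtain ⟨R, M, hR0, hM0, -, hDzero, hDle⟩ := exists_sliceDeriv_bound_box hΦ hΦc
  refine ⟨R, M, hR0, hM0, fun ξ ↦ ⟨fun y ↦ hasDerivAt_fourier_slice hΦ hΦc ξ y,
    continuous_fourier_sliceDeriv hΦ hΦc ξ, fun y ↦ ?_⟩⟩
  have h := norm_fourier_sliceDeriv_le (Φ := Φ) (a := -R) (b := R) (by linarith) hDle
    (fun t₁ y ht ↦ hDzero t₁ y (by rw [mem_Icc, ← abs_le, not_le] at ht; exact ht)) y ξ
  simpa [two_mul, sub_neg_eq_add] using h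

end Summit.Parity.GeneralizedHardyLittlewood.Theorems.BeyondDiagonalBeatsQuarter.OffDiag
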